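import Summits.Ventures.DiscreteObjects.Hadamard.PrimeOrderOrbitRows

/-!
# Hadamard 668 census, family F12 — the orbit-row identities from a tactical decomposition (kernel),
# and the prime-order theorem as a statement about incidence matrices

Framing: lottery ticket; floor = certified bounds/negative ranges.

Cell pub-namedobj (venture DiscreteObjects), target (H), hadamard gen 5 (FAMILY-F12-G5 §7/§9).  Until now every F12
kernel theorem certified an INTEGER SYSTEM whose derivation from 'automorphism of the design' was on paper
(FAMILY-F12 §2).  This file proves the two orbit-row identities used by `PrimeOrderOrbitRows` inside the kernel, from
hypotheses that are exactly the standard properties of the orbit partition of an automorphism (a tactical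
decomposition): let `N : P → B → ℤ` be a `0/1` incidence function with constant row sums `k` and constant inner products
`λ` of distinct rows (the point half of "symmetric 2-design"); let `O` be a set of `p` points (a point-orbit) and let the
blocks be partitioned into classes of size `p` indexed by `ι` (the block-orbits of length `p`, `cls y = some j`) and
singletons (`cls y = none`, the fixed blocks), such that (i) the number of blocks of class `j` through a point of `O` is a
constant `w j` (`hw`), (ii) the number of points of `O` on a block of class `j` is the same constant (`hw'` — for orbits
both equal `|{flags between O and class j}| / p`), (iii) a fixed block through the base point `x₀ ∈ O` contains `O`
(`hfix`).  THEN (`orbitRow_identities`): `Σ_j w j = k - σ` and `Σ_j (w j)² + p σ = k + λ (p - 1)`, where `σ` is the number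
of fixed blocks through `x₀` — by double counting the pairs `(x, y)` with `x ∈ O` and `y` a block through `x₀` and `x`.
COROLLARY (`no_tactical_orbitRow667`): with `k = 333`, `λ = 166`, block classes indexed by `Fin m` and `(p, m)` in the
table `csPairs667` of `PrimeOrderOrbitRows`, such a configuration does not exist.  What remains on paper for the census
statement 'no automorphism of order p' (FAMILY-F12-G5 §7): orbits of a cyclic group of prime order have length 1 or p
and form a tactical decomposition with (i)–(iii); the numbers of point- and block-orbits of length p agree (orbit
theorem); Lander's parity theorem and Feit's bound select the admissible m.  Ours, not literature; no `sorry`.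
-/

open Finset BigOperators

namespace Summit.Ventures.DiscreteObjects.Hadamard

/-- **Orbit-row identities from a tactical decomposition.**  See the module docstring for the hypotheses.
Conclusion: `Σ_j w j = k - σ` and `Σ_j (w j)^2 + p σ = k + λ (p - 1)` with `σ = #{fixed blocks through x₀}`. -/
theorem orbitRow_identities {P B ι : Type*} [Fintype P] [DecidableEq P] [Fintype B] [DecidableEq B]
    [Fintype ι] [DecidableEq ι]
    (N : P → B → ℤ) (h01 : ∀ x y, N x y = 0 ∨ N x y = 1) (k lam : ℤ)
    (hrow : ∀ x, ∑ y, N x y = k) (hpair : ∀ x x', x ≠ x' → ∑ y, N x y * N x' y = lam)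
    (O : Finset P) (p : ℕ) (hO : O.card = p) (x₀ : P) (hx₀ : x₀ ∈ O)
    (cls : B → Option ι)
    (w : ι → ℤ) (hw : ∀ x ∈ O, ∀ j, ∑ y ∈ univ.filter (fun y => cls y = some j), N x y = w j)
    (hw' : ∀ j y, cls y = some j → ∑ x ∈ O, N x y = w j)
    (hfix : ∀ y, cls y = none → N x₀ y = 1 → ∀ x ∈ O, N x y = 1)
    (σ : ℤ) (hσ : ∑ y ∈ univ.filter (fun y => cls y = none), N x₀ y = σ) :
    ∑ j, w j = k - σ ∧ ∑ j, (w j) ^ 2 + p * σ = k + lam * (p - 1) := by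
  -- splitting a sum over blocks along the class map
  have split : ∀ f : B → ℤ, ∑ y, f y = ∑ y ∈ univ.filter (fun y => cls y = none), f y
      + ∑ j, ∑ y ∈ univ.filter (fun y => cls y = some j), f y := by
    intro f
    rw [← Finset.sum_fiberwise (s := (univ : Finset B)) (g := cls) (f := f), Fintype.sum_option]
  constructor
  · -- first identity: row sum of x₀
    have h := hrow x₀
    rw [split] at h
    rw [hσ] at h
    have : ∑ j, ∑ y ∈ univ.filter (fun y => cls y = some j), N x₀ y = ∑ j, w j :=
      Finset.sum_congr rfl fun j _ => hw x₀ hx₀ j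
    rw [this] at h
    linarith
  · -- second identity: double count T = Σ_{x ∈ O} Σ_y N x₀ y * N x y
    set T := ∑ x ∈ O, ∑ y, N x₀ y * N x y with hT
    -- (a) via the design equations
    have hNN : ∀ y, N x₀ y * N x₀ y = N x₀ y := fun y => by rcases h01 x₀ y with h | h <;> simp [h]
    have Ta : T = k + lam * (p - 1) := by
      have e1 : ∑ y, N x₀ y * N x₀ y = k := by
        rw [Finset.sum_congr rfl (fun y _ => hNN y)]; exact hrow x₀
      have e2 : ∀ x ∈ O.erase x₀, ∑ y, N x₀ y * N x y = lam :=
        fun x hx => hpair x₀ x (Finset.ne_of_mem_erase hx).symm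
      rw [hT, ← Finset.add_sum_erase O _ hx₀, e1, Finset.sum_congr rfl e2, Finset.sum_const,
        Finset.card_erase_of_mem hx₀, hO]
      simp only [nsmul_eq_mul]
      have hp : 1 ≤ p := by rw [← hO]; exact Finset.card_pos.mpr ⟨x₀, hx₀⟩
      push_cast [Nat.cast_sub hp]
      ring
    -- (b) via the classes
    have Tb : T = ∑ j, (w j) ^ 2 + p * σ := by
      have step1 : T = ∑ y, N x₀ y * ∑ x ∈ O, N x y := by
        rw [hT, Finset.sum_comm]
        exact Finset.sum_congr rfl fun y _ => by rw [Finset.mul_sum]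
      rw [step1, split]
      -- fixed blocks: N x₀ y * Σ_{x∈O} N x y = p * N x₀ y
      have fixpart : ∑ y ∈ univ.filter (fun y => cls y = none), N x₀ y * ∑ x ∈ O, N x y
          = p * σ := by
        rw [← hσ, Finset.mul_sum]
        refine Finset.sum_congr rfl fun y hy => ?_
        have hy' : cls y = none := (Finset.mem_filter.mp hy).2
        rcases h01 x₀ y with h0 | h1
        · simp [h0]
        · have hall : ∑ x ∈ O, N x y = p := by
            rw [Finset.sum_congr rfl (fun x hx => hfix y hy' h1 x hx), Finset.sum_const, hO]
            simp
          rw [hall, h1]; ring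
      -- orbit classes: Σ_{y in class j} N x₀ y * w j = w j * w j
      have clspart : ∀ j, ∑ y ∈ univ.filter (fun y => cls y = some j), N x₀ y * ∑ x ∈ O, N x y = (w j) ^ 2 := by
        intro j
        have : ∀ y ∈ univ.filter (fun y => cls y = some j), N x₀ y * ∑ x ∈ O, N x y = N x₀ y * w j :=
          fun y hy => by rw [hw' j y (Finset.mem_filter.mp hy).2]
        rw [Finset.sum_congr rfl this, ← Finset.sum_mul, hw x₀ hx₀ j]; ring
      rw [fixpart, Finset.sum_congr rfl (fun j _ => clspart j)]
      ring
    rw [← Tb, Ta]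

/-- **No automorphism of order p (tactical form).**  A `0/1` incidence function on `667 × 667`… more generally on any
finite point/block types with row sums `333` and row inner products `166`, a `p`-set `O` of points and a partition of
the blocks into `m` classes of size `p` plus singletons with the tactical properties (i)–(iii) of the module docstring,
cannot exist when `(p, m) ∈ csPairs667` (`PrimeOrderOrbitRows`). -/
theorem no_tactical_orbitRow667 {P B : Type*} [Fintype P] [DecidableEq P] [Fintype B] [DecidableEq B]
    (N : P → B → ℤ) (h01 : ∀ x y, N x y = 0 ∨ N x y = 1)
    (hrow : ∀ x, ∑ y, N x y = 333) (hpair : ∀ x x', x ≠ x' → ∑ y, N x y * N x' y = 166)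
    (p m : ℕ) (hmem : (p, m) ∈ csPairs667)
    (O : Finset P) (hO : O.card = p) (x₀ : P) (hx₀ : x₀ ∈ O)
    (cls : B → Option (Fin m))
    (w : Fin m → ℤ) (hw : ∀ x ∈ O, ∀ j, ∑ y ∈ univ.filter (fun y => cls y = some j), N x y = w j)
    (hw' : ∀ j y, cls y = some j → ∑ x ∈ O, N x y = w j)
    (hfix : ∀ y, cls y = none → N x₀ y = 1 → ∀ x ∈ O, N x y = 1) : False := by
  obtain ⟨h1, h2⟩ := orbitRow_identities N h01 333 166 hrow hpair O p hO x₀ hx₀ cls w hw hw' hfix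
    (∑ y ∈ univ.filter (fun y => cls y = none), N x₀ y) rfl
  refine no_orbitRow667_of_mem p m hmem (∑ y ∈ univ.filter (fun y => cls y = none), N x₀ y) w h1 ?_
  linarith

end Summit.Ventures.DiscreteObjects.Hadamard
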